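import Mathlib
import HarnessLib

/-!
# Route `GenusKolyvaginAtTwo`, crux U_T `ShaCardDvdPowAtTwoRT` (stmt-BirchSwinnertonDyer-23658; upper half
# `#Ш(E/K)[2^∞] ∣ 2^(2M₀)`) — NORM/TATE LOSS ACCOUNTING: for a finite abelian group with an involution,
# `#X = #(1+τ)X · #(1−τ)X · #Ĥ⁰(τ, X)` and `#Ĥ⁰ = #Ĥ⁻¹`; the descent frame `Ĥ⁰(τ, X) ≅ res⁻¹(X) / cores(X)`

Seat `bsd-line-gk2-p3` g26 (PROVER seat 3/3, cell `bsd-f1-sign2`), `--supports stmt-BirchSwinnertonDyer-23658` (helper; closes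
nothing).  Mathlib-only algebra.  THEOREMS ONLY (no definition, no named fact, no `sorry`).  BSD is NOT proved by any of this;
neither is U_T nor any stub.

WHY (this lineage's U_T memo `Cruxes/ShaCardDvdPowAtTwoRT/Lines/norm-sharp-upper-gk2p3.md` §15, and its sequel
`Lines/norm-tate-accounting-gk2p3g26.md`).  Put `X = Ш(E/K)[2^∞]` (finite) with the involution `τ` induced by complex conjugation
(`conjAct`), `N₊ = 1 + τ`, `N₋ = 1 − τ`.  Kolyvagin's classes are `τ`-eigen (Gross Prop. 5.4), i.e. killed by `N₋` or by `N₊`, and the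
`K`-side duality laws they yield at `p = 2` are statements about the NORM IMAGES `N₊X`, `N₋X` (the sharp norm law
`2^(M₀)·(1 + wτ)·Sel_(2^M)(E/K) = 0`, gk2-p5 p745283; the norm-sharp rung certificate, g25 p742544, exact on free `ℤ/2^N[C₂]`-summands).
This file records the EXACT bookkeeping identity behind g25 §15's «one invisible bit per ±-summand»:

  `#X = #N₊X · #N₋X · #Ĥ⁰(τ, X)`,  `Ĥ⁰(τ, X) := X^τ / N₊X = ker N₋ / im N₊`,  and  `#Ĥ⁰(τ, X) = #Ĥ⁻¹(τ, X)`  (`Ĥ⁻¹ := ker N₊ / im N₋`)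

— the Herbrand quotient of a finite `C₂`-module is `1` (Serre, *Local Fields* VIII §4 Prop. 8), unwound.  It is the NORM-IMAGE form of
this lineage's eigenspace count `#A^{τ=+1} · #A^{τ=−1} = #A · #H¹(C₂, A)` (g20, `…PowDvdShaCardAtTwoRTJointCountOverK`
`natCard_ker_sub_mul_natCard_ker_add`, written for L_T's lower count; `#A^{τ=±1} = #A/#N_∓A`), the form that the SHARP NORM LAWS
speak to (`2^(M₀)·N_w Sel = 0` bounds the exponent of a norm image, not of an eigenspace).  Consequences: the order of
`X` is the product of the two norm images EXACTLY when `X` is cohomologically trivial (e.g. free over `ℤ/2^N[C₂]`, the regular frame),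
and in general **U_T ⟺ (NormBound) ∧ (TateBound)**: `#N₊X ∣ 2^a`, `#N₋X ∣ 2^b`, `#Ĥ⁰(τ,X) ∣ 2^c`, `a + b + c ≤ 2M₀ ⟹ #X ∣ 2^(2M₀)`
(`natCard_dvd_pow_of_norm_tate_bounds`).  The second half (§3) is the DESCENT FRAME that computes `Ĥ⁰` on the `ℚ`-side: for abelian
groups `H_ℚ`, `H_K`, maps `res : H_ℚ → H_K`, `cor : H_K → H_ℚ` with `res ∘ cor = 1 + τ`, `res` injective with image the `τ`-invariants
(inf–res on the habitat: `E(K)[2] = 0`), and a `τ`-stable subgroup `X ≤ H_K` (a Selmer group, or `Ш`):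
`X^τ = res(res⁻¹ X)`, `N₊X = res(cor X)`, hence **`#Ĥ⁰(τ, X) = [res⁻¹(X) : cor(X)]`** (`natCard_tateH0_eq_natCard_quotient_comap_map`) —
on the habitat `res⁻¹(Sel_(2^M)(E/K))` is the `ℚ`-Selmer group RELAXED at the primes of `d_K` and `cor(Sel(E/K)) ≤ Sel(E/ℚ)`, so the
invisible bits are `[S_ℚ : Sel(E/ℚ)] · [Sel(E/ℚ) : cor Sel(E/K)]` (memo §2–§3; typed arithmetic instantiation = the successor file).

* §1 `range_id_add_le_ker_id_sub`, `range_id_sub_le_ker_id_add`, `add_apply_add_sub_apply` — `N₋ ∘ N₊ = 0 = N₊ ∘ N₋`, `N₊ + N₋ = 2`.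
* §2 **`natCard_eq_natCard_range_mul_range_mul_tateH0`** (`#X = #N₊X · #N₋X · #Ĥ⁰`), `natCard_tateH0_eq_natCard_tateHneg1`
  (`#Ĥ⁰ = #Ĥ⁻¹`), `natCard_range_mul_range_dvd` (`#N₊X · #N₋X ∣ #X`), `natCard_eq_natCard_range_mul_range_of_tateH0_trivial`,
  **`natCard_dvd_pow_of_norm_tate_bounds`** (U_T's accounting form).
* §3 **`natCard_tateH0_eq_natCard_quotient_comap_map`** — the descent frame: `#(X^τ/N₊X) = #(res⁻¹X / cor X)`; with
  `map_cor_le_comap_res` (`cor X ≤ res⁻¹ X`), `res_comap_eq_fixed` (`res(res⁻¹X) = X^τ` elementwise), `res_map_cor_eq_norm`.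

References: [SerreLocalFields1979] VIII §4 Prop. 8 (`h(A) = 1` for finite `A`); [McCallumLMS1991] §5 Thm. 5.4/5.8 (the count);
[GrossLMS1991] Prop. 5.4 (eigen-classes); [MilneADT2006] I Cor. 2.3 / Hochschild–Serre (`res ∘ cor = N`, inf–res).
-/

set_option autoImplicit false
-- `Summit.<P>.<Sub>` repeats `BirchSwinnertonDyer` by the tree's layout convention (D-0017)
set_option linter.dupNamespace false

namespace Summit.BirchSwinnertonDyer.BirchSwinnertonDyer.Theorems.GenusExact.PlusDescent

section NormTate

variable {X : Type*} [AddCommGroup X] (τ : X →+ X)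

/-! ## §1 The two norms `N₊ = 1 + τ`, `N₋ = 1 − τ` of an involution -/

/-- `N₊ x = x + τ x`. [folklore] -/
theorem id_add_apply (x : X) : (AddMonoidHom.id X + τ) x = x + τ x := rfl

/-- `N₋ x = x − τ x`. [folklore] -/
theorem id_sub_apply (x : X) : (AddMonoidHom.id X - τ) x = x - τ x := rfl

/-- `N₊ x + N₋ x = 2 • x`. [folklore] -/
theorem add_apply_add_sub_apply (x : X) :
    (AddMonoidHom.id X + τ) x + (AddMonoidHom.id X - τ) x = (2 : ℤ) • x := by
  simp only [AddMonoidHom.add_apply, AddMonoidHom.sub_apply, AddMonoidHom.id_apply]; abel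

variable (hτ : ∀ x, τ (τ x) = x)
include hτ

/-- `N₋ (N₊ x) = 0` for an involution `τ`. [folklore] -/
theorem sub_apply_add_apply_eq_zero (x : X) :
    (AddMonoidHom.id X - τ) ((AddMonoidHom.id X + τ) x) = 0 := by
  simp only [AddMonoidHom.add_apply, AddMonoidHom.sub_apply, AddMonoidHom.id_apply, map_add, hτ]; abel

/-- `N₊ (N₋ x) = 0` for an involution `τ`. [folklore] -/
theorem add_apply_sub_apply_eq_zero (x : X) :
    (AddMonoidHom.id X + τ) ((AddMonoidHom.id X - τ) x) = 0 := by
  simp only [AddMonoidHom.add_apply, AddMonoidHom.sub_apply, AddMonoidHom.id_apply, map_sub, hτ]; abel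

/-- `im N₊ ≤ ker N₋`: every norm is `τ`-fixed. [folklore] -/
theorem range_id_add_le_ker_id_sub : (AddMonoidHom.id X + τ).range ≤ (AddMonoidHom.id X - τ).ker := by
  rintro _ ⟨x, rfl⟩
  exact (AddMonoidHom.mem_ker).mpr (sub_apply_add_apply_eq_zero τ hτ x)

/-- `im N₋ ≤ ker N₊`: every conorm is `τ`-anti-fixed. [folklore] -/
theorem range_id_sub_le_ker_id_add : (AddMonoidHom.id X - τ).range ≤ (AddMonoidHom.id X + τ).ker := by
  rintro _ ⟨x, rfl⟩
  exact (AddMonoidHom.mem_ker).mpr (add_apply_sub_apply_eq_zero τ hτ x)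

omit hτ in
/-- `ker N₋` is the fixed subgroup: `x ∈ ker N₋ ↔ τ x = x`. [folklore] -/
theorem mem_ker_sub_iff (x : X) : x ∈ (AddMonoidHom.id X - τ).ker ↔ τ x = x := by
  rw [AddMonoidHom.mem_ker, AddMonoidHom.sub_apply, AddMonoidHom.id_apply, sub_eq_zero, eq_comm]

omit hτ in
/-- `ker N₊` is the anti-fixed subgroup: `x ∈ ker N₊ ↔ τ x = -x`. [folklore] -/
theorem mem_ker_add_iff (x : X) : x ∈ (AddMonoidHom.id X + τ).ker ↔ τ x = -x := by
  rw [AddMonoidHom.mem_ker, AddMonoidHom.add_apply, AddMonoidHom.id_apply, add_comm, add_eq_zero_iff_eq_neg]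

omit hτ in
/-- `−τ` is an involution when `τ` is. [folklore] -/
theorem neg_neg_apply (hτ : ∀ x, τ (τ x) = x) (x : X) : (-τ) ((-τ) x) = x := by
  simp [map_neg, hτ]

omit hτ in
/-- `1 + (−τ) = 1 − τ`. [folklore] -/
theorem id_add_neg_eq : AddMonoidHom.id X + (-τ) = AddMonoidHom.id X - τ := by
  ext x; simp [sub_eq_add_neg]

omit hτ in
/-- `1 − (−τ) = 1 + τ`. [folklore] -/
theorem id_sub_neg_eq : AddMonoidHom.id X - (-τ) = AddMonoidHom.id X + τ := by
  ext x; simp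

/-! ## §2 The accounting identity `#X = #N₊X · #N₋X · #Ĥ⁰` and `#Ĥ⁰ = #Ĥ⁻¹` -/

omit hτ in
/-- `#X = #(im f) · #(ker f)` for an endomorphism `f` (first isomorphism theorem + Lagrange). [folklore] -/
theorem natCard_eq_natCard_range_mul_natCard_ker (f : X →+ X) :
    Nat.card X = Nat.card f.range * Nat.card f.ker := by
  rw [AddSubgroup.card_eq_card_quotient_mul_card_addSubgroup f.ker,
    Nat.card_congr (QuotientAddGroup.quotientKerEquivRange f).toEquiv]

/-- **`#(ker N₋) = #Ĥ⁰ · #(im N₊)`** with `Ĥ⁰ := ker N₋ / im N₊` (Lagrange in `ker N₋`, using `im N₊ ≤ ker N₋`). [folklore] -/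
theorem natCard_ker_sub_eq_natCard_tateH0_mul_natCard_range_add :
    Nat.card (AddMonoidHom.id X - τ).ker =
      Nat.card ((AddMonoidHom.id X - τ).ker ⧸ ((AddMonoidHom.id X + τ).range).addSubgroupOf (AddMonoidHom.id X - τ).ker) *
        Nat.card (AddMonoidHom.id X + τ).range := by
  rw [AddSubgroup.card_eq_card_quotient_mul_card_addSubgroup
      (((AddMonoidHom.id X + τ).range).addSubgroupOf (AddMonoidHom.id X - τ).ker),
    Nat.card_congr (AddSubgroup.addSubgroupOfEquivOfLe (range_id_add_le_ker_id_sub τ hτ)).toEquiv]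

/-- **NORM/TATE ACCOUNTING: `#X = #N₊X · #N₋X · #Ĥ⁰(τ, X)`** for an abelian group `X` with an involution `τ`
(`N₊ = 1 + τ`, `N₋ = 1 − τ`, `Ĥ⁰ = ker N₋ / im N₊`; all cardinalities `Nat.card`, so the identity is between natural numbers and
is `0 = 0` when `X` is infinite).  Proof: `#X = #(im N₋)·#(ker N₋)` and `#(ker N₋) = #Ĥ⁰·#(im N₊)`.
[cite: SerreLocalFields1979, VIII §4 Prop. 8] -/
theorem natCard_eq_natCard_range_mul_range_mul_tateH0 :
    Nat.card X = Nat.card (AddMonoidHom.id X + τ).range * Nat.card (AddMonoidHom.id X - τ).range *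
      Nat.card ((AddMonoidHom.id X - τ).ker ⧸ ((AddMonoidHom.id X + τ).range).addSubgroupOf (AddMonoidHom.id X - τ).ker) := by
  rw [natCard_eq_natCard_range_mul_natCard_ker (AddMonoidHom.id X - τ),
    natCard_ker_sub_eq_natCard_tateH0_mul_natCard_range_add τ hτ]
  ring

/-- The same identity with the roles of `N₊` and `N₋` exchanged: `#X = #N₊X · #N₋X · #Ĥ⁻¹(τ, X)`, `Ĥ⁻¹ := ker N₊ / im N₋`
(apply the previous theorem to the involution `−τ`). [cite: SerreLocalFields1979, VIII §4 Prop. 8] -/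
theorem natCard_eq_natCard_range_mul_range_mul_tateHneg1 :
    Nat.card X = Nat.card (AddMonoidHom.id X + τ).range * Nat.card (AddMonoidHom.id X - τ).range *
      Nat.card ((AddMonoidHom.id X + τ).ker ⧸ ((AddMonoidHom.id X - τ).range).addSubgroupOf (AddMonoidHom.id X + τ).ker) := by
  have h := natCard_eq_natCard_range_mul_range_mul_tateH0 (-τ) (neg_neg_apply τ hτ)
  rw [id_add_neg_eq, id_sub_neg_eq] at h
  rw [h]; ring

/-- **The Herbrand quotient of a finite `C₂`-module is `1`: `#Ĥ⁰(τ, X) = #Ĥ⁻¹(τ, X)`**, i.e.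
`#(ker N₋ / im N₊) = #(ker N₊ / im N₋)` for a FINITE abelian group `X` with an involution `τ`.
[cite: SerreLocalFields1979, VIII §4 Prop. 8] -/
theorem natCard_tateH0_eq_natCard_tateHneg1 [Finite X] :
    Nat.card ((AddMonoidHom.id X - τ).ker ⧸ ((AddMonoidHom.id X + τ).range).addSubgroupOf (AddMonoidHom.id X - τ).ker) =
      Nat.card ((AddMonoidHom.id X + τ).ker ⧸ ((AddMonoidHom.id X - τ).range).addSubgroupOf (AddMonoidHom.id X + τ).ker) := by
  have h0 := natCard_eq_natCard_range_mul_range_mul_tateH0 τ hτ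
  have h1 := natCard_eq_natCard_range_mul_range_mul_tateHneg1 τ hτ
  have hpos : 0 < Nat.card (AddMonoidHom.id X + τ).range * Nat.card (AddMonoidHom.id X - τ).range :=
    Nat.mul_pos Nat.card_pos Nat.card_pos
  exact Nat.eq_of_mul_eq_mul_left hpos (h0.symm.trans h1)

/-- `#N₊X · #N₋X ∣ #X` (the cofactor is `#Ĥ⁰`). [cite: SerreLocalFields1979, VIII §4 Prop. 8] -/
theorem natCard_range_mul_range_dvd :
    Nat.card (AddMonoidHom.id X + τ).range * Nat.card (AddMonoidHom.id X - τ).range ∣ Nat.card X :=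
  Dvd.intro _ (natCard_eq_natCard_range_mul_range_mul_tateH0 τ hτ).symm

/-- **Cohomologically trivial case**: if `Ĥ⁰(τ, X) = 0`, i.e. every `τ`-fixed element is a norm `y + τ y`, then
`#X = #N₊X · #N₋X` — the norm images account for the whole group (e.g. `X` free over `ℤ/2^N[C₂]`, the regular frame).
[cite: SerreLocalFields1979, VIII §4 Prop. 8] -/
theorem natCard_eq_natCard_range_mul_range_of_tateH0_trivial
    (hH0 : ∀ x, τ x = x → ∃ y, y + τ y = x) :
    Nat.card X = Nat.card (AddMonoidHom.id X + τ).range * Nat.card (AddMonoidHom.id X - τ).range := by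
  rw [natCard_eq_natCard_range_mul_range_mul_tateH0 τ hτ]
  suffices hsub : Subsingleton ((AddMonoidHom.id X - τ).ker ⧸
      ((AddMonoidHom.id X + τ).range).addSubgroupOf (AddMonoidHom.id X - τ).ker) by
    rw [Nat.card_of_subsingleton (0 : (AddMonoidHom.id X - τ).ker ⧸
      ((AddMonoidHom.id X + τ).range).addSubgroupOf (AddMonoidHom.id X - τ).ker), mul_one]
  refine ⟨fun a b => ?_⟩
  induction a using QuotientAddGroup.induction_on with
  | H a =>
    induction b using QuotientAddGroup.induction_on with
    | H b =>
      refine QuotientAddGroup.eq.mpr ?_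
      rw [AddSubgroup.mem_addSubgroupOf]
      have ha : τ (-(a : X) + b) = -(a : X) + b := by
        rw [map_add, map_neg, (mem_ker_sub_iff τ _).mp a.2, (mem_ker_sub_iff τ _).mp b.2]
      obtain ⟨y, hy⟩ := hH0 _ ha
      exact ⟨y, by simpa [AddMonoidHom.add_apply] using hy⟩

/-- Conversely, in a FINITE `X`: if `#X = #N₊X · #N₋X` then `Ĥ⁰(τ, X) = 0` (every fixed element is a norm).
[cite: SerreLocalFields1979, VIII §4 Prop. 8] -/
theorem exists_norm_eq_of_fixed_of_natCard_eq [Finite X]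
    (hcard : Nat.card X = Nat.card (AddMonoidHom.id X + τ).range * Nat.card (AddMonoidHom.id X - τ).range)
    {x : X} (hx : τ x = x) : ∃ y, y + τ y = x := by
  have h0 := natCard_eq_natCard_range_mul_range_mul_tateH0 τ hτ
  have hpos : 0 < Nat.card (AddMonoidHom.id X + τ).range * Nat.card (AddMonoidHom.id X - τ).range :=
    Nat.mul_pos Nat.card_pos Nat.card_pos
  have hone : Nat.card ((AddMonoidHom.id X - τ).ker ⧸
      ((AddMonoidHom.id X + τ).range).addSubgroupOf (AddMonoidHom.id X - τ).ker) = 1 := by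
    have : Nat.card (AddMonoidHom.id X + τ).range * Nat.card (AddMonoidHom.id X - τ).range * 1 =
        Nat.card (AddMonoidHom.id X + τ).range * Nat.card (AddMonoidHom.id X - τ).range *
          Nat.card ((AddMonoidHom.id X - τ).ker ⧸
            ((AddMonoidHom.id X + τ).range).addSubgroupOf (AddMonoidHom.id X - τ).ker) := by
      rw [mul_one]; exact hcard.symm.trans h0
    exact (Nat.eq_of_mul_eq_mul_left hpos this).symm
  haveI : Subsingleton ((AddMonoidHom.id X - τ).ker ⧸
      ((AddMonoidHom.id X + τ).range).addSubgroupOf (AddMonoidHom.id X - τ).ker) :=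
    (Nat.card_eq_one_iff_unique.mp hone).1
  have hxker : x ∈ (AddMonoidHom.id X - τ).ker := (mem_ker_sub_iff τ x).mpr hx
  have hq : (QuotientAddGroup.mk (⟨x, hxker⟩ : (AddMonoidHom.id X - τ).ker) :
      (AddMonoidHom.id X - τ).ker ⧸ ((AddMonoidHom.id X + τ).range).addSubgroupOf (AddMonoidHom.id X - τ).ker) =
        QuotientAddGroup.mk 0 := Subsingleton.elim _ _
  have hmem := (QuotientAddGroup.eq.mp hq.symm)
  rw [AddSubgroup.mem_addSubgroupOf] at hmem
  obtain ⟨y, hy⟩ := hmem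
  refine ⟨y, ?_⟩
  simpa [AddMonoidHom.add_apply] using hy

/-- **U_T's accounting form.**  If the two norm images and the Tate cohomology group are bounded by powers of a number `p`,
`#N₊X ∣ p^a`, `#N₋X ∣ p^b`, `#Ĥ⁰(τ, X) ∣ p^c`, then `#X ∣ p^(a+b+c)`; with `p = 2`, `X = Ш(E/K)[2^∞]` and `a + b + c ≤ 2M₀` this is
the conclusion `#Ш(E/K)[2^∞] ∣ 2^(2M₀)` of U_T: **U_T ⟸ NormBound ∧ TateBound**. [cite: McCallumLMS1991, §5 Thm. 5.8] -/
theorem natCard_dvd_pow_of_norm_tate_bounds {p a b c : ℕ}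
    (ha : Nat.card (AddMonoidHom.id X + τ).range ∣ p ^ a) (hb : Nat.card (AddMonoidHom.id X - τ).range ∣ p ^ b)
    (hc : Nat.card ((AddMonoidHom.id X - τ).ker ⧸
      ((AddMonoidHom.id X + τ).range).addSubgroupOf (AddMonoidHom.id X - τ).ker) ∣ p ^ c) :
    Nat.card X ∣ p ^ (a + b + c) := by
  rw [natCard_eq_natCard_range_mul_range_mul_tateH0 τ hτ, pow_add, pow_add]
  exact mul_dvd_mul (mul_dvd_mul ha hb) hc

/-- The same bound read with a total budget: `a + b + c ≤ n ⟹ #X ∣ p^n`. [cite: McCallumLMS1991, §5 Thm. 5.8] -/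
theorem natCard_dvd_pow_of_norm_tate_bounds_le {p a b c n : ℕ} (hn : a + b + c ≤ n)
    (ha : Nat.card (AddMonoidHom.id X + τ).range ∣ p ^ a) (hb : Nat.card (AddMonoidHom.id X - τ).range ∣ p ^ b)
    (hc : Nat.card ((AddMonoidHom.id X - τ).ker ⧸
      ((AddMonoidHom.id X + τ).range).addSubgroupOf (AddMonoidHom.id X - τ).ker) ∣ p ^ c) :
    Nat.card X ∣ p ^ n :=
  (natCard_dvd_pow_of_norm_tate_bounds τ hτ ha hb hc).trans (pow_dvd_pow p hn)

end NormTate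

/-! ## §3 The descent frame: `Ĥ⁰(τ, X) ≅ res⁻¹(X) / cor(X)` -/

section DescentFrame

variable {HQ HK : Type*} [AddCommGroup HQ] [AddCommGroup HK]
  (res : HQ →+ HK) (cor : HK →+ HQ) (τ : HK →+ HK)
  (hrc : ∀ x, res (cor x) = x + τ x)
  (hinj : Function.Injective res)
  (hfix : ∀ b, τ (res b) = res b)
  (hsurj : ∀ x, τ x = x → ∃ b, res b = x)
  (X : AddSubgroup HK) (hX : ∀ x ∈ X, τ x ∈ X)

/-- The involution restricted to a `τ`-stable subgroup `X`, as an endomorphism of `↥X`. -/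
-- (a local abbreviation would be a `def`; we inline the term `(τ.comp X.subtype).codRestrict X _` in every statement)
theorem codRestrict_apply_coe (x : X) :
    (((τ.comp X.subtype).codRestrict X (fun y => hX y y.2)) x : HK) = τ x := rfl

include hX hrc in
/-- `cor X ≤ res⁻¹ X`: `res (cor x) = x + τx ∈ X` for `x ∈ X`. [folklore] -/
theorem map_cor_le_comap_res : X.map cor ≤ X.comap res := by
  rintro _ ⟨x, hx, rfl⟩
  simp only [AddSubgroup.mem_comap] -- goal: res (cor x) ∈ X
  rw [hrc]
  exact X.add_mem hx (hX x hx)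

include hfix hsurj in
/-- `res (res⁻¹ X) = X^τ`: an element of `X` is `τ`-fixed iff it is `res b` for some `b ∈ res⁻¹ X`. [folklore] -/
theorem mem_fixed_iff_exists_res (x : HK) (hx : x ∈ X) : τ x = x ↔ ∃ b ∈ X.comap res, res b = x := by
  constructor
  · intro h
    obtain ⟨b, rfl⟩ := hsurj x h
    exact ⟨b, by simpa [AddSubgroup.mem_comap] using hx, rfl⟩
  · rintro ⟨b, -, rfl⟩
    exact hfix b

include hrc in
/-- `res (cor X) = N₊ X` elementwise. [folklore] -/
theorem res_map_cor_eq_norm (x : HK) : res (cor x) = (AddMonoidHom.id HK + τ) x := by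
  rw [hrc]; rfl

include hrc hinj hfix hsurj in
/-- **THE DESCENT FRAME: `#Ĥ⁰(τ, X) = [res⁻¹(X) : cor(X)]`.**  For abelian groups `H_ℚ`, `H_K` with `res : H_ℚ → H_K` injective onto
the `τ`-fixed elements (inf–res), `cor : H_K → H_ℚ` with `res ∘ cor = 1 + τ`, and a `τ`-stable subgroup `X ≤ H_K`:
`#( (↥X)^τ / N₊(↥X) ) = #( res⁻¹X / cor X )`.  On the habitat (`H_K = Sel`-ambient `H¹(K, E[2^M])`, `H_ℚ = H¹(ℚ, E[2^M])`,
`X = Sel_(2^M)(E/K)` or its image `Ш[2^M]`-layer) the right side is `[S_ℚ : Sel(E/ℚ)]·[Sel(E/ℚ) : cor Sel(E/K)]` with `S_ℚ` the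
`ℚ`-Selmer group relaxed at the primes of `d_K` — the `ℚ`-side count of the bits no `K`-side eigen certificate sees.
[cite: MilneADT2006, I Cor. 2.3] -/
theorem natCard_tateH0_eq_natCard_quotient_comap_map :
    Nat.card ((AddMonoidHom.id X - (τ.comp X.subtype).codRestrict X (fun y => hX y y.2)).ker ⧸
        ((AddMonoidHom.id X + (τ.comp X.subtype).codRestrict X (fun y => hX y y.2)).range).addSubgroupOf
          (AddMonoidHom.id X - (τ.comp X.subtype).codRestrict X (fun y => hX y y.2)).ker) =
      Nat.card (X.comap res ⧸ (X.map cor).addSubgroupOf (X.comap res)) := by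
  classical
  set τX : X →+ X := (τ.comp X.subtype).codRestrict X (fun y => hX y y.2) with hτX
  -- the map `res⁻¹ X → ker N₋(X)`, `b ↦ ⟨res b, _⟩`
  have hmemX : ∀ b : X.comap res, res b ∈ X := fun b => AddSubgroup.mem_comap.mp b.2
  have hker : ∀ b : X.comap res, (⟨res b, hmemX b⟩ : X) ∈ (AddMonoidHom.id X - τX).ker := fun b => by
    rw [AddMonoidHom.mem_ker, AddMonoidHom.sub_apply, sub_eq_zero]
    ext; simp [hτX, hfix]
  let φ : X.comap res →+ (AddMonoidHom.id X - τX).ker :=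
    { toFun := fun b => ⟨⟨res b, hmemX b⟩, hker b⟩
      map_zero' := by ext; simp
      map_add' := fun a b => by ext; simp }
  have hφ_bij : Function.Bijective φ := by
    constructor
    · intro a b hab
      have : res a = res b := by
        have := congrArg (fun z : (AddMonoidHom.id X - τX).ker => ((z : X) : HK)) hab
        simpa [φ] using this
      exact Subtype.ext (hinj this)
    · intro z
      have hzfix : τ (z : X) = (z : X) := by
        have hz := z.2
        rw [AddMonoidHom.mem_ker, AddMonoidHom.sub_apply, sub_eq_zero] at hz
        have := congrArg (fun w : X => (w : HK)) hz
        simpa [hτX] using this.symm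
      obtain ⟨b, hb, hbres⟩ := (mem_fixed_iff_exists_res res τ hfix hsurj X (z : X) (z : X).2).mp hzfix
      refine ⟨⟨b, hb⟩, ?_⟩
      ext; simpa [φ] using hbres
  let e : X.comap res ≃+ (AddMonoidHom.id X - τX).ker := AddEquiv.ofBijective φ hφ_bij
  -- `e` carries `cor X` onto `im N₊(X)`
  have himage : ((X.map cor).addSubgroupOf (X.comap res)).map e.toAddMonoidHom =
      ((AddMonoidHom.id X + τX).range).addSubgroupOf (AddMonoidHom.id X - τX).ker := by
    ext z
    simp only [AddSubgroup.mem_map, AddSubgroup.mem_addSubgroupOf, AddSubgroup.mem_map, AddMonoidHom.mem_range]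
    constructor
    · rintro ⟨b, ⟨x, hx, hxb⟩, rfl⟩
      refine ⟨⟨x, hx⟩, ?_⟩
      ext
      simp only [AddEquiv.toAddMonoidHom_eq_coe, AddMonoidHom.coe_coe, AddEquiv.ofBijective_apply, e, φ]
      change (((AddMonoidHom.id X + τX) ⟨x, hx⟩ : X) : HK) = res (b : HQ)
      rw [← hxb, hrc]; simp [hτX, AddMonoidHom.add_apply]
    · rintro ⟨x, hxz⟩
      have hcor : cor (x : HK) ∈ X.comap res := by
        rw [AddSubgroup.mem_comap, hrc]; exact X.add_mem x.2 (hX _ x.2)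
      refine ⟨⟨cor x, hcor⟩, ⟨x, x.2, rfl⟩, ?_⟩
      ext
      have := congrArg (fun w : X => (w : HK)) hxz
      simp only [AddMonoidHom.add_apply, AddMonoidHom.id_apply, AddSubgroup.coe_add] at this
      simp only [AddEquiv.toAddMonoidHom_eq_coe, AddMonoidHom.coe_coe, AddEquiv.ofBijective_apply, e, φ]
      change res (cor (x : HK)) = ((z : X) : HK)
      rw [hrc, ← this]; simp [hτX]
  -- quotients by corresponding subgroups have the same cardinality
  rw [← himage]
  exact (Nat.card_congr (QuotientAddGroup.congr ((X.map cor).addSubgroupOf (X.comap res)) _ e rfl).toEquiv).symm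

end DescentFrame

end Summit.BirchSwinnertonDyer.BirchSwinnertonDyer.Theorems.GenusExact.PlusDescent
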